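import Literature.NumberTheory.EllipticCurves.ModFiveCongruenceHesseFamily
import Literature.NumberTheory.EllipticCurves.QuadraticTwist
import Summits.BirchSwinnertonDyer.Rank1Residual.O6.X4CongruenceAnchor
import HarnessLib

/-!
# Route `QuadraticBranchSignedControl` (rung K8, cell `bsd-potss`), residual crux `PlusEtaMainConjectureNonsurj`
# (stmt-BirchSwinnertonDyer-19606): kernel records of the mod-`5` congruence binders of the per-row records —
# part E (CORRECTION of the unit-anchor census: the four CM unit SIBLINGS have `5`-twists ADDITIVE at `5`): TWIST side — the 16 rows of the `2700p1` / `675a1` / `14400l1` / `11025b1` classes re-anchored at the RANK-1 CM anchors of record (twists GOOD at `5`, `a_5 = 0`), for all models of both `5`-twists (a `--supports … --as helper` file; seat `bsd-potss-k8eta-c2` g8; ROUTE-FREE; nothing booked, BSD is not proved by any of this)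

WHAT. The per-row records of crux 19606 landed by seats k8eta-c2 g4 (`EtaPrimeRoadRecords` / `…ByName`: the 9 non-CM
RANK-ONE rows with PRIME `L_5⁺` and a CM unit anchor), g6 (`EtaFineRoadRecords` parts A/B: the 7 TAMAGAWA rank-0 rows
through the rank-1 CM anchors `2700p1` / `675a1` / `14400l1`) and g7 (`EtaFineRoadRecords` parts C/D/E: the same 7 rows + 5
prime-`L` rank-1 rows through the RANK-0 CM UNIT SIBLINGS `[0,0,0,0,−675]`, `[0,0,1,0,−169]`, `[0,0,0,0,800]`,
`[0,0,1,0,−405169]`) all DISPLAY the mod-`5` congruence between the row and its anchor as a hypothesis (`hcong :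
ModPCongruent W A 5` on the curve side, resp. `ModPCongruent V′ V 5` between arbitrary models of the two `5`-twists on the
twist side), whose only evidence was numerical (Kraus–Oesterlé trace certificates, kit j270119 / j270714; Fisher-family
points read numerically, kit j281329 / j281670). Seat `bsd-potss-conjA-anchor` g7 has since typed Fisher's two explicit
families of `5`-congruent curves as NAMED PUBLISHED FACTS (Literature `HesseFamilyFive.thm132_geomTorsionFive_of_hesseFamily`
= Fisher, PLMS 104 (2012) Thm. 13.2 (i), direct family; `thm58_geomTorsionFive_of_dualHesseFamily` = Fisher, Math. Ann. 356
(2013) Thm. 5.8, indirect family; p543671 / p545896) together with PROVED certificate forms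
`congr_of_{direct,indirect}Certificate` (four identities of rational numbers per pair). THIS FILE discharges the K8 binders
from those facts: each record proves, for ONE explicit pair, `ModPCongruent … 5` MODULO ONE NAMED PUBLISHED FACT, by a
kernel-checked certificate — the member's invariants are `(c₄, c₆) = (v⁴𝔠₄(λ,μ), v⁶𝔠₆(λ,μ))` (direct) resp.
`((4/9)v⁴𝔠₄, (8/27)v⁶𝔠₆)` (indirect) for Fisher's Hesse polynomials of the base curve at an explicit rational point
`(λ:μ)` and scalar `v`. Base curve = the CM anchor / sibling `A` (`j = 0`, `c₄(A) = 0`); member = the row (curve side),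
resp. base = `A^{(5)}`, member = `W^{(5)}` in the tree's model `WeierstrassCurve.quadraticTwist` (`c₄ ↦ 25c₄`,
`c₆ ↦ 125c₆`, `quadraticTwist_c₄/₆`), transported to arbitrary models `V′ = C′ • A^{(5)}`, `V = C • W^{(5)}` by
`congr_of_smul_eq` (twist side). Certificates found and verified exactly by this seat's `work/kit/k8pairs.py` (28/28 pairs,
one family point each; table `pub/bsd-potss/k8eta-c2/g8/K8-FISHER-CERTS-k8eta-c2-g8.tsv`) over conjA-anchor g7's exact
engine `hesse5.py`. USE: `Eta…Records….<record> … (hcong := EtaModFiveCongruenceRecords.modPCongruent_<row>_<A> hF W A hW hA) …`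
— the `_fisher` re-issues in `…PlusEtaNonsurjFineRoadRecordsFisher.lean` / `…PrimeLFunctionRecordsFisher.lean`.
HONEST FRAMING (cell `bsd-potss`; HUMAN RULING D-0036/D-0074): kernel plumbing + one PUB fact per record; no definition,
no new fact, no `sorry`, axioms standard; crux 19606 is NOT closed (class-wide = Coates–Sujatha's Conjecture A on the
additive partners + (E⁺_η)); nothing is booked; BSD(W,5) is claimed for no pair.

References: [Fisher2012Hessian] §8, Def. 13.1, Thm. 13.2; [Fisher2013TwistsOfX5] Lemma 5.6, Thm. 5.8; [SilvermanAEC2009]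
III.1, X.2; [LimSujatha2018] Prop. 3.2 and [HatleyLei2019] Thm. 4.6 (the consumers of the binder); [Cremona1997] Table 1.
-/

set_option autoImplicit false
set_option linter.dupNamespace false

noncomputable section

namespace Summit.BirchSwinnertonDyer.BirchSwinnertonDyer.Theorems.EtaModFiveCongruenceRecords

open WeierstrassCurve Literature.NumberTheory.EllipticCurves.HesseFamilyFive Summit.BirchSwinnertonDyer.Rank1Residual.O6

/-- Row `78300bh1` = `[0, 0, 0, -705375, 135465750]` of crux 19606 (K8, `p = 5`, non-CM, rank `1`, prime `L_5⁺`) and its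
rank-`1` CM anchor of record `2700p1` = `[0,0,0,0,500]` (DRS-3.7 certificate for (A), kit j277504): for ALL Weierstrass models
`V′` of the `5`-twist of the anchor and `V` of the `5`-twist of the row, `V′[5] ≃ V[5]` `Γ_ℚ`-equivariantly
(`ModPCongruent V′ V 5`, the displayed binder of `EtaCMConjAAnchorTransferRecords.etaMC_78300bh1_5_cmConjAAnchorTransfer`) — the
twisted row `W^{(5)}` (`c₄ = 846450000`, `c₆ = -14630301000000`) is the member `(λ:μ) = (600 : 1)` of the DIRECT Hesse family of
the twisted anchor `W′^{(5)}` (`c₄ = 0`, `c₆ = -54000000`), rescaled by `v = 1/233280000000000` (exact certificate,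
work/kit/k8pairs.py); models by `congr_of_smul_eq`. Conditional on the named fact `thm132_geomTorsionFive_of_hesseFamily` only.
[cite: Fisher2012Hessian, Thm. 13.2 (i)] [cite: SilvermanAEC2009, X.2 (the quadratic twist; c₄ ↦ d²c₄, c₆ ↦ d³c₆)] -/
theorem modPCongruent_twist5_2700p1_78300bh1 (hF : thm132_geomTorsionFive_of_hesseFamily)
    (W' W : WeierstrassCurve ℚ) [W'.IsElliptic] [W.IsElliptic]
    (hW' : W' = ⟨0, 0, 0, 0, 500⟩) (hW : W = ⟨0, 0, 0, (-705375), 135465750⟩) :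
    ∀ (V' V : WeierstrassCurve ℚ),
      (∃ C' : VariableChange ℚ, C' • W'.quadraticTwist (5) = V') →
      (∃ C : VariableChange ℚ, C • W.quadraticTwist (5) = V) → ModPCongruent V' V 5 := by
  intro V' V hC' hC
  obtain ⟨C', hC'⟩ := hC'
  obtain ⟨C, hC⟩ := hC
  have h5 : (5 : ℚ) ≠ 0 := by norm_num
  haveI := W'.isElliptic_quadraticTwist h5
  haveI := W.isElliptic_quadraticTwist h5
  have hT : Congr (W.quadraticTwist 5) (W'.quadraticTwist 5) :=
    congr_of_directCertificate hF (W'.quadraticTwist 5) (W.quadraticTwist 5) 0 (-54000000) 600 1 (1 / 233280000000000) (by norm_num)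
      (by rw [WeierstrassCurve.quadraticTwist_c₄, hW']; norm_num [WeierstrassCurve.c₄, WeierstrassCurve.b₂, WeierstrassCurve.b₄])
      (by rw [WeierstrassCurve.quadraticTwist_c₆, hW']; norm_num [WeierstrassCurve.c₆, WeierstrassCurve.b₂, WeierstrassCurve.b₄, WeierstrassCurve.b₆])
      (by rw [WeierstrassCurve.quadraticTwist_c₄, hW]; norm_num [WeierstrassCurve.c₄, WeierstrassCurve.b₂, WeierstrassCurve.b₄, C4, Dll, Dlm, Dmm])
      (by rw [WeierstrassCurve.quadraticTwist_c₆, hW]; norm_num [WeierstrassCurve.c₆, WeierstrassCurve.b₂, WeierstrassCurve.b₄, WeierstrassCurve.b₆, C6, C4l, C4m, Dl, Dm, Dll, Dlm, Dmm, Dlll, Dllm, Dlmm, Dmmm])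
  exact congr_trans (congr_symm (congr_of_smul_eq C' hC')) (congr_trans (congr_symm hT) (congr_of_smul_eq C hC))

/-- Row `159300l1` = `[0, 0, 0, -121125, 12756625]` of crux 19606 (K8, `p = 5`, non-CM, rank `1`, prime `L_5⁺`) and its rank-`1`
CM anchor of record `2700p1` = `[0,0,0,0,500]` (DRS-3.7 certificate for (A), kit j277504): for ALL Weierstrass models `V′` of
the `5`-twist of the anchor and `V` of the `5`-twist of the row, `V′[5] ≃ V[5]` `Γ_ℚ`-equivariantly (`ModPCongruent V′ V 5`, the
displayed binder of `EtaCMConjAAnchorTransferRecords.etaMC_159300l1_5_cmConjAAnchorTransfer`) — the twisted row `W^{(5)}`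
(`c₄ = 145350000`, `c₆ = -1377715500000`) is the member `(λ:μ) = (600 : 1)` of the INDIRECT Hesse family of the twisted anchor
`W′^{(5)}` (`c₄ = 0`, `c₆ = -54000000`), rescaled by `v = 1/12597120000000000000000` (exact certificate, work/kit/k8pairs.py);
models by `congr_of_smul_eq`. Conditional on the named fact `thm58_geomTorsionFive_of_dualHesseFamily` only.
[cite: Fisher2013TwistsOfX5, Thm. 5.8] [cite: SilvermanAEC2009, X.2 (the quadratic twist; c₄ ↦ d²c₄, c₆ ↦ d³c₆)] -/
theorem modPCongruent_twist5_2700p1_159300l1 (hF : thm58_geomTorsionFive_of_dualHesseFamily)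
    (W' W : WeierstrassCurve ℚ) [W'.IsElliptic] [W.IsElliptic]
    (hW' : W' = ⟨0, 0, 0, 0, 500⟩) (hW : W = ⟨0, 0, 0, (-121125), 12756625⟩) :
    ∀ (V' V : WeierstrassCurve ℚ),
      (∃ C' : VariableChange ℚ, C' • W'.quadraticTwist (5) = V') →
      (∃ C : VariableChange ℚ, C • W.quadraticTwist (5) = V) → ModPCongruent V' V 5 := by
  intro V' V hC' hC
  obtain ⟨C', hC'⟩ := hC'
  obtain ⟨C, hC⟩ := hC
  have h5 : (5 : ℚ) ≠ 0 := by norm_num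
  haveI := W'.isElliptic_quadraticTwist h5
  haveI := W.isElliptic_quadraticTwist h5
  have hT : Congr (W.quadraticTwist 5) (W'.quadraticTwist 5) :=
    congr_of_indirectCertificate hF (W'.quadraticTwist 5) (W.quadraticTwist 5) 0 (-54000000) 600 1 (1 / 12597120000000000000000) (by norm_num)
      (by rw [WeierstrassCurve.quadraticTwist_c₄, hW']; norm_num [WeierstrassCurve.c₄, WeierstrassCurve.b₂, WeierstrassCurve.b₄])
      (by rw [WeierstrassCurve.quadraticTwist_c₆, hW']; norm_num [WeierstrassCurve.c₆, WeierstrassCurve.b₂, WeierstrassCurve.b₄, WeierstrassCurve.b₆])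
      (by rw [WeierstrassCurve.quadraticTwist_c₄, hW]; norm_num [WeierstrassCurve.c₄, WeierstrassCurve.b₂, WeierstrassCurve.b₄, C4i, Dlli, Dlmi, Dmmi])
      (by rw [WeierstrassCurve.quadraticTwist_c₆, hW]; norm_num [WeierstrassCurve.c₆, WeierstrassCurve.b₂, WeierstrassCurve.b₄, WeierstrassCurve.b₆, C6i, C4li, C4mi, Dli, Dmi, Dlli, Dlmi, Dmmi, Dllli, Dllmi, Dlmmi, Dmmmi])
  exact congr_trans (congr_symm (congr_of_smul_eq C' hC')) (congr_trans (congr_symm hT) (congr_of_smul_eq C hC))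

/-- Row `162675n1` = `[0, 0, 1, -10374750, -13063103719]` of crux 19606 (K8, `p = 5`, non-CM, rank `1`, prime `L_5⁺`) and its
rank-`1` CM anchor of record `675a1` = `[0,0,1,0,31]` (DRS-3.7 certificate for (A), kit j277504): for ALL Weierstrass models
`V′` of the `5`-twist of the anchor and `V` of the `5`-twist of the row, `V′[5] ≃ V[5]` `Γ_ℚ`-equivariantly
(`ModPCongruent V′ V 5`, the displayed binder of `EtaCMConjAAnchorTransferRecords.etaMC_162675n1_5_cmConjAAnchorTransfer`) — the
twisted row `W^{(5)}` (`c₄ = 12449700000`, `c₆ = 1410815201625000`) is the member `(λ:μ) = (600 : 1)` of the DIRECT Hesse family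
of the twisted anchor `W′^{(5)}` (`c₄ = 0`, `c₆ = -3375000`), rescaled by `v = 1/7290000000000` (exact certificate,
work/kit/k8pairs.py); models by `congr_of_smul_eq`. Conditional on the named fact `thm132_geomTorsionFive_of_hesseFamily` only.
[cite: Fisher2012Hessian, Thm. 13.2 (i)] [cite: SilvermanAEC2009, X.2 (the quadratic twist; c₄ ↦ d²c₄, c₆ ↦ d³c₆)] -/
theorem modPCongruent_twist5_675a1_162675n1 (hF : thm132_geomTorsionFive_of_hesseFamily)
    (W' W : WeierstrassCurve ℚ) [W'.IsElliptic] [W.IsElliptic]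
    (hW' : W' = ⟨0, 0, 1, 0, 31⟩) (hW : W = ⟨0, 0, 1, (-10374750), (-13063103719)⟩) :
    ∀ (V' V : WeierstrassCurve ℚ),
      (∃ C' : VariableChange ℚ, C' • W'.quadraticTwist (5) = V') →
      (∃ C : VariableChange ℚ, C • W.quadraticTwist (5) = V) → ModPCongruent V' V 5 := by
  intro V' V hC' hC
  obtain ⟨C', hC'⟩ := hC'
  obtain ⟨C, hC⟩ := hC
  have h5 : (5 : ℚ) ≠ 0 := by norm_num
  haveI := W'.isElliptic_quadraticTwist h5
  haveI := W.isElliptic_quadraticTwist h5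
  have hT : Congr (W.quadraticTwist 5) (W'.quadraticTwist 5) :=
    congr_of_directCertificate hF (W'.quadraticTwist 5) (W.quadraticTwist 5) 0 (-3375000) 600 1 (1 / 7290000000000) (by norm_num)
      (by rw [WeierstrassCurve.quadraticTwist_c₄, hW']; norm_num [WeierstrassCurve.c₄, WeierstrassCurve.b₂, WeierstrassCurve.b₄])
      (by rw [WeierstrassCurve.quadraticTwist_c₆, hW']; norm_num [WeierstrassCurve.c₆, WeierstrassCurve.b₂, WeierstrassCurve.b₄, WeierstrassCurve.b₆])
      (by rw [WeierstrassCurve.quadraticTwist_c₄, hW]; norm_num [WeierstrassCurve.c₄, WeierstrassCurve.b₂, WeierstrassCurve.b₄, C4, Dll, Dlm, Dmm])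
      (by rw [WeierstrassCurve.quadraticTwist_c₆, hW]; norm_num [WeierstrassCurve.c₆, WeierstrassCurve.b₂, WeierstrassCurve.b₄, WeierstrassCurve.b₆, C6, C4l, C4m, Dl, Dm, Dll, Dlm, Dmm, Dlll, Dllm, Dlmm, Dmmm])
  exact congr_trans (congr_symm (congr_of_smul_eq C' hC')) (congr_trans (congr_symm hT) (congr_of_smul_eq C hC))

/-- Row `164700i1` = `[0, 0, 0, -119963625, -505734387375]` of crux 19606 (K8, `p = 5`, non-CM, rank `1`, prime `L_5⁺`) and its
rank-`1` CM anchor of record `2700p1` = `[0,0,0,0,500]` (DRS-3.7 certificate for (A), kit j277504): for ALL Weierstrass models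
`V′` of the `5`-twist of the anchor and `V` of the `5`-twist of the row, `V′[5] ≃ V[5]` `Γ_ℚ`-equivariantly
(`ModPCongruent V′ V 5`, the displayed binder of `EtaCMConjAAnchorTransferRecords.etaMC_164700i1_5_cmConjAAnchorTransfer`) — the
twisted row `W^{(5)}` (`c₄ = 143956350000`, `c₆ = 54619313836500000`) is the member `(λ:μ) = (1200 : 1)` of the DIRECT Hesse
family of the twisted anchor `W′^{(5)}` (`c₄ = 0`, `c₆ = -54000000`), rescaled by `v = 1/311040000000000` (exact certificate,
work/kit/k8pairs.py); models by `congr_of_smul_eq`. Conditional on the named fact `thm132_geomTorsionFive_of_hesseFamily` only.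
[cite: Fisher2012Hessian, Thm. 13.2 (i)] [cite: SilvermanAEC2009, X.2 (the quadratic twist; c₄ ↦ d²c₄, c₆ ↦ d³c₆)] -/
theorem modPCongruent_twist5_2700p1_164700i1 (hF : thm132_geomTorsionFive_of_hesseFamily)
    (W' W : WeierstrassCurve ℚ) [W'.IsElliptic] [W.IsElliptic]
    (hW' : W' = ⟨0, 0, 0, 0, 500⟩) (hW : W = ⟨0, 0, 0, (-119963625), (-505734387375)⟩) :
    ∀ (V' V : WeierstrassCurve ℚ),
      (∃ C' : VariableChange ℚ, C' • W'.quadraticTwist (5) = V') →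
      (∃ C : VariableChange ℚ, C • W.quadraticTwist (5) = V) → ModPCongruent V' V 5 := by
  intro V' V hC' hC
  obtain ⟨C', hC'⟩ := hC'
  obtain ⟨C, hC⟩ := hC
  have h5 : (5 : ℚ) ≠ 0 := by norm_num
  haveI := W'.isElliptic_quadraticTwist h5
  haveI := W.isElliptic_quadraticTwist h5
  have hT : Congr (W.quadraticTwist 5) (W'.quadraticTwist 5) :=
    congr_of_directCertificate hF (W'.quadraticTwist 5) (W.quadraticTwist 5) 0 (-54000000) 1200 1 (1 / 311040000000000) (by norm_num)
      (by rw [WeierstrassCurve.quadraticTwist_c₄, hW']; norm_num [WeierstrassCurve.c₄, WeierstrassCurve.b₂, WeierstrassCurve.b₄])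
      (by rw [WeierstrassCurve.quadraticTwist_c₆, hW']; norm_num [WeierstrassCurve.c₆, WeierstrassCurve.b₂, WeierstrassCurve.b₄, WeierstrassCurve.b₆])
      (by rw [WeierstrassCurve.quadraticTwist_c₄, hW]; norm_num [WeierstrassCurve.c₄, WeierstrassCurve.b₂, WeierstrassCurve.b₄, C4, Dll, Dlm, Dmm])
      (by rw [WeierstrassCurve.quadraticTwist_c₆, hW]; norm_num [WeierstrassCurve.c₆, WeierstrassCurve.b₂, WeierstrassCurve.b₄, WeierstrassCurve.b₆, C6, C4l, C4m, Dl, Dm, Dll, Dlm, Dmm, Dlll, Dllm, Dlmm, Dmmm])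
  exact congr_trans (congr_symm (congr_of_smul_eq C' hC')) (congr_trans (congr_symm hT) (congr_of_smul_eq C hC))

/-- Row `164700n1` = `[0, 0, 0, -1079672625, 13654828459125]` of crux 19606 (K8, `p = 5`, non-CM, rank `1`, prime `L_5⁺`) and
its rank-`1` CM anchor of record `2700p1` = `[0,0,0,0,500]` (DRS-3.7 certificate for (A), kit j277504): for ALL Weierstrass
models `V′` of the `5`-twist of the anchor and `V` of the `5`-twist of the row, `V′[5] ≃ V[5]` `Γ_ℚ`-equivariantly
(`ModPCongruent V′ V 5`, the displayed binder of `EtaCMConjAAnchorTransferRecords.etaMC_164700n1_5_cmConjAAnchorTransfer`) — the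
twisted row `W^{(5)}` (`c₄ = 1295607150000`, `c₆ = -1474721473585500000`) is the member `(λ:μ) = (-600 : 1)` of the INDIRECT
Hesse family of the twisted anchor `W′^{(5)}` (`c₄ = 0`, `c₆ = -54000000`), rescaled by `v = 1/1399680000000000000000` (exact
certificate, work/kit/k8pairs.py); models by `congr_of_smul_eq`. Conditional on the named fact
`thm58_geomTorsionFive_of_dualHesseFamily` only. [cite: Fisher2013TwistsOfX5, Thm. 5.8]
[cite: SilvermanAEC2009, X.2 (the quadratic twist; c₄ ↦ d²c₄, c₆ ↦ d³c₆)] -/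
theorem modPCongruent_twist5_2700p1_164700n1 (hF : thm58_geomTorsionFive_of_dualHesseFamily)
    (W' W : WeierstrassCurve ℚ) [W'.IsElliptic] [W.IsElliptic]
    (hW' : W' = ⟨0, 0, 0, 0, 500⟩) (hW : W = ⟨0, 0, 0, (-1079672625), 13654828459125⟩) :
    ∀ (V' V : WeierstrassCurve ℚ),
      (∃ C' : VariableChange ℚ, C' • W'.quadraticTwist (5) = V') →
      (∃ C : VariableChange ℚ, C • W.quadraticTwist (5) = V) → ModPCongruent V' V 5 := by
  intro V' V hC' hC
  obtain ⟨C', hC'⟩ := hC'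
  obtain ⟨C, hC⟩ := hC
  have h5 : (5 : ℚ) ≠ 0 := by norm_num
  haveI := W'.isElliptic_quadraticTwist h5
  haveI := W.isElliptic_quadraticTwist h5
  have hT : Congr (W.quadraticTwist 5) (W'.quadraticTwist 5) :=
    congr_of_indirectCertificate hF (W'.quadraticTwist 5) (W.quadraticTwist 5) 0 (-54000000) (-600) 1 (1 / 1399680000000000000000) (by norm_num)
      (by rw [WeierstrassCurve.quadraticTwist_c₄, hW']; norm_num [WeierstrassCurve.c₄, WeierstrassCurve.b₂, WeierstrassCurve.b₄])
      (by rw [WeierstrassCurve.quadraticTwist_c₆, hW']; norm_num [WeierstrassCurve.c₆, WeierstrassCurve.b₂, WeierstrassCurve.b₄, WeierstrassCurve.b₆])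
      (by rw [WeierstrassCurve.quadraticTwist_c₄, hW]; norm_num [WeierstrassCurve.c₄, WeierstrassCurve.b₂, WeierstrassCurve.b₄, C4i, Dlli, Dlmi, Dmmi])
      (by rw [WeierstrassCurve.quadraticTwist_c₆, hW]; norm_num [WeierstrassCurve.c₆, WeierstrassCurve.b₂, WeierstrassCurve.b₄, WeierstrassCurve.b₆, C6i, C4li, C4mi, Dli, Dmi, Dlli, Dlmi, Dmmi, Dllli, Dllmi, Dlmmi, Dmmmi])
  exact congr_trans (congr_symm (congr_of_smul_eq C' hC')) (congr_trans (congr_symm hT) (congr_of_smul_eq C hC))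

/-- Row `404325f1` = `[0, 0, 1, -277006500, 1774389583406]` of crux 19606 (K8, `p = 5`, non-CM, rank `1`, prime `L_5⁺`) and its
rank-`1` CM anchor of record `675a1` = `[0,0,1,0,31]` (DRS-3.7 certificate for (A), kit j277504): for ALL Weierstrass models
`V′` of the `5`-twist of the anchor and `V` of the `5`-twist of the row, `V′[5] ≃ V[5]` `Γ_ℚ`-equivariantly
(`ModPCongruent V′ V 5`, the displayed binder of `EtaCMConjAAnchorTransferRecords.etaMC_404325f1_5_cmConjAAnchorTransfer`) — the
twisted row `W^{(5)}` (`c₄ = 332407800000`, `c₆ = -191634075007875000`) is the member `(λ:μ) = (150 : 1)` of the DIRECT Hesse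
family of the twisted anchor `W′^{(5)}` (`c₄ = 0`, `c₆ = -3375000`), rescaled by `v = 1/227812500000` (exact certificate,
work/kit/k8pairs.py); models by `congr_of_smul_eq`. Conditional on the named fact `thm132_geomTorsionFive_of_hesseFamily` only.
[cite: Fisher2012Hessian, Thm. 13.2 (i)] [cite: SilvermanAEC2009, X.2 (the quadratic twist; c₄ ↦ d²c₄, c₆ ↦ d³c₆)] -/
theorem modPCongruent_twist5_675a1_404325f1 (hF : thm132_geomTorsionFive_of_hesseFamily)
    (W' W : WeierstrassCurve ℚ) [W'.IsElliptic] [W.IsElliptic]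
    (hW' : W' = ⟨0, 0, 1, 0, 31⟩) (hW : W = ⟨0, 0, 1, (-277006500), 1774389583406⟩) :
    ∀ (V' V : WeierstrassCurve ℚ),
      (∃ C' : VariableChange ℚ, C' • W'.quadraticTwist (5) = V') →
      (∃ C : VariableChange ℚ, C • W.quadraticTwist (5) = V) → ModPCongruent V' V 5 := by
  intro V' V hC' hC
  obtain ⟨C', hC'⟩ := hC'
  obtain ⟨C, hC⟩ := hC
  have h5 : (5 : ℚ) ≠ 0 := by norm_num
  haveI := W'.isElliptic_quadraticTwist h5
  haveI := W.isElliptic_quadraticTwist h5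
  have hT : Congr (W.quadraticTwist 5) (W'.quadraticTwist 5) :=
    congr_of_directCertificate hF (W'.quadraticTwist 5) (W.quadraticTwist 5) 0 (-3375000) 150 1 (1 / 227812500000) (by norm_num)
      (by rw [WeierstrassCurve.quadraticTwist_c₄, hW']; norm_num [WeierstrassCurve.c₄, WeierstrassCurve.b₂, WeierstrassCurve.b₄])
      (by rw [WeierstrassCurve.quadraticTwist_c₆, hW']; norm_num [WeierstrassCurve.c₆, WeierstrassCurve.b₂, WeierstrassCurve.b₄, WeierstrassCurve.b₆])
      (by rw [WeierstrassCurve.quadraticTwist_c₄, hW]; norm_num [WeierstrassCurve.c₄, WeierstrassCurve.b₂, WeierstrassCurve.b₄, C4, Dll, Dlm, Dmm])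
      (by rw [WeierstrassCurve.quadraticTwist_c₆, hW]; norm_num [WeierstrassCurve.c₆, WeierstrassCurve.b₂, WeierstrassCurve.b₄, WeierstrassCurve.b₆, C6, C4l, C4m, Dl, Dm, Dll, Dlm, Dmm, Dlll, Dllm, Dlmm, Dmmm])
  exact congr_trans (congr_symm (congr_of_smul_eq C' hC')) (congr_trans (congr_symm hT) (congr_of_smul_eq C hC))

/-- Row `417600fp1` = `[0, 0, 0, -310500, -139239000]` of crux 19606 (K8, `p = 5`, non-CM, rank `1`, prime `L_5⁺`) and its
rank-`1` CM anchor of record `14400l1` = `[0,0,0,0,1000]` (DRS-3.7 certificate for (A), kit j277504): for ALL Weierstrass models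
`V′` of the `5`-twist of the anchor and `V` of the `5`-twist of the row, `V′[5] ≃ V[5]` `Γ_ℚ`-equivariantly
(`ModPCongruent V′ V 5`, the displayed binder of `EtaCMConjAAnchorTransferRecords.etaMC_417600fp1_5_cmConjAAnchorTransfer`) —
the twisted row `W^{(5)}` (`c₄ = 372600000`, `c₆ = 15037812000000`) is the member `(λ:μ) = (-600 : 1)` of the DIRECT Hesse
family of the twisted anchor `W′^{(5)}` (`c₄ = 0`, `c₆ = -108000000`), rescaled by `v = 1/699840000000000` (exact certificate,
work/kit/k8pairs.py); models by `congr_of_smul_eq`. Conditional on the named fact `thm132_geomTorsionFive_of_hesseFamily` only.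
[cite: Fisher2012Hessian, Thm. 13.2 (i)] [cite: SilvermanAEC2009, X.2 (the quadratic twist; c₄ ↦ d²c₄, c₆ ↦ d³c₆)] -/
theorem modPCongruent_twist5_14400l1_417600fp1 (hF : thm132_geomTorsionFive_of_hesseFamily)
    (W' W : WeierstrassCurve ℚ) [W'.IsElliptic] [W.IsElliptic]
    (hW' : W' = ⟨0, 0, 0, 0, 1000⟩) (hW : W = ⟨0, 0, 0, (-310500), (-139239000)⟩) :
    ∀ (V' V : WeierstrassCurve ℚ),
      (∃ C' : VariableChange ℚ, C' • W'.quadraticTwist (5) = V') →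
      (∃ C : VariableChange ℚ, C • W.quadraticTwist (5) = V) → ModPCongruent V' V 5 := by
  intro V' V hC' hC
  obtain ⟨C', hC'⟩ := hC'
  obtain ⟨C, hC⟩ := hC
  have h5 : (5 : ℚ) ≠ 0 := by norm_num
  haveI := W'.isElliptic_quadraticTwist h5
  haveI := W.isElliptic_quadraticTwist h5
  have hT : Congr (W.quadraticTwist 5) (W'.quadraticTwist 5) :=
    congr_of_directCertificate hF (W'.quadraticTwist 5) (W.quadraticTwist 5) 0 (-108000000) (-600) 1 (1 / 699840000000000) (by norm_num)
      (by rw [WeierstrassCurve.quadraticTwist_c₄, hW']; norm_num [WeierstrassCurve.c₄, WeierstrassCurve.b₂, WeierstrassCurve.b₄])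
      (by rw [WeierstrassCurve.quadraticTwist_c₆, hW']; norm_num [WeierstrassCurve.c₆, WeierstrassCurve.b₂, WeierstrassCurve.b₄, WeierstrassCurve.b₆])
      (by rw [WeierstrassCurve.quadraticTwist_c₄, hW]; norm_num [WeierstrassCurve.c₄, WeierstrassCurve.b₂, WeierstrassCurve.b₄, C4, Dll, Dlm, Dmm])
      (by rw [WeierstrassCurve.quadraticTwist_c₆, hW]; norm_num [WeierstrassCurve.c₆, WeierstrassCurve.b₂, WeierstrassCurve.b₄, WeierstrassCurve.b₆, C6, C4l, C4m, Dl, Dm, Dll, Dlm, Dmm, Dlll, Dllm, Dlmm, Dmmm])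
  exact congr_trans (congr_symm (congr_of_smul_eq C' hC')) (congr_trans (congr_symm hT) (congr_of_smul_eq C hC))

/-- Row `78300bd1` = `[0, 0, 0, -78375, -5017250]` of crux 19606 (K8, `p = 5`, non-CM, rank `1`, prime `L_5⁺`) and its rank-`1`
CM anchor of record `2700p1` = `[0,0,0,0,500]` (DRS-3.7 certificate for (A), kit j277504): for ALL Weierstrass models `V′` of
the `5`-twist of the anchor and `V` of the `5`-twist of the row, `V′[5] ≃ V[5]` `Γ_ℚ`-equivariantly (`ModPCongruent V′ V 5`, the
displayed binder of `EtaCMConjAAnchorTransferRecords.etaMC_78300bd1_5_cmConjAAnchorTransfer`) — the twisted row `W^{(5)}`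
(`c₄ = 94050000`, `c₆ = 541863000000`) is the member `(λ:μ) = (-300 : 1)` of the INDIRECT Hesse family of the twisted anchor
`W′^{(5)}` (`c₄ = 0`, `c₆ = -54000000`), rescaled by `v = 1/3149280000000000000000` (exact certificate, work/kit/k8pairs.py);
models by `congr_of_smul_eq`. Conditional on the named fact `thm58_geomTorsionFive_of_dualHesseFamily` only.
[cite: Fisher2013TwistsOfX5, Thm. 5.8] [cite: SilvermanAEC2009, X.2 (the quadratic twist; c₄ ↦ d²c₄, c₆ ↦ d³c₆)] -/
theorem modPCongruent_twist5_2700p1_78300bd1 (hF : thm58_geomTorsionFive_of_dualHesseFamily)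
    (W' W : WeierstrassCurve ℚ) [W'.IsElliptic] [W.IsElliptic]
    (hW' : W' = ⟨0, 0, 0, 0, 500⟩) (hW : W = ⟨0, 0, 0, (-78375), (-5017250)⟩) :
    ∀ (V' V : WeierstrassCurve ℚ),
      (∃ C' : VariableChange ℚ, C' • W'.quadraticTwist (5) = V') →
      (∃ C : VariableChange ℚ, C • W.quadraticTwist (5) = V) → ModPCongruent V' V 5 := by
  intro V' V hC' hC
  obtain ⟨C', hC'⟩ := hC'
  obtain ⟨C, hC⟩ := hC
  have h5 : (5 : ℚ) ≠ 0 := by norm_num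
  haveI := W'.isElliptic_quadraticTwist h5
  haveI := W.isElliptic_quadraticTwist h5
  have hT : Congr (W.quadraticTwist 5) (W'.quadraticTwist 5) :=
    congr_of_indirectCertificate hF (W'.quadraticTwist 5) (W.quadraticTwist 5) 0 (-54000000) (-300) 1 (1 / 3149280000000000000000) (by norm_num)
      (by rw [WeierstrassCurve.quadraticTwist_c₄, hW']; norm_num [WeierstrassCurve.c₄, WeierstrassCurve.b₂, WeierstrassCurve.b₄])
      (by rw [WeierstrassCurve.quadraticTwist_c₆, hW']; norm_num [WeierstrassCurve.c₆, WeierstrassCurve.b₂, WeierstrassCurve.b₄, WeierstrassCurve.b₆])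
      (by rw [WeierstrassCurve.quadraticTwist_c₄, hW]; norm_num [WeierstrassCurve.c₄, WeierstrassCurve.b₂, WeierstrassCurve.b₄, C4i, Dlli, Dlmi, Dmmi])
      (by rw [WeierstrassCurve.quadraticTwist_c₆, hW]; norm_num [WeierstrassCurve.c₆, WeierstrassCurve.b₂, WeierstrassCurve.b₄, WeierstrassCurve.b₆, C6i, C4li, C4mi, Dli, Dmi, Dlli, Dlmi, Dmmi, Dllli, Dllmi, Dlmmi, Dmmmi])
  exact congr_trans (congr_symm (congr_of_smul_eq C' hC')) (congr_trans (congr_symm hT) (congr_of_smul_eq C hC))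

end Summit.BirchSwinnertonDyer.BirchSwinnertonDyer.Theorems.EtaModFiveCongruenceRecords

end
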